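import Mathlib
import Literature.MathematicalPhysics.QuantumFieldTheory.ConstructiveQFTWave0
import Literature.MathematicalPhysics.QuantumFieldTheory.WilsonFlow
import Literature.MathematicalPhysics.QuantumFieldTheory.ConstructiveQFTBalabanRG
import Literature.MathematicalPhysics.QuantumLattice.GaugeGroups
import HarnessLib

/-!
# Lüscher 2010 — trivializing maps, the Wilson flow and the HMC algorithm. File A: transport, link calculus, flows
M. Lüscher, *Trivializing maps, the Wilson flow and the HMC algorithm*, Commun. Math. Phys. 293 (2010)
899–919, arXiv:0907.5491 [Luscher2010Trivializing]. Statement-level typing (published definitions/results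
only, each with its citation tag; nothing here is new mathematics). Authored by the pub-lqcd theory-1 seats
(cell lqcd-flow), file of record `HOME/lean/theory1/LuscherA_TrivializingMaps.lean`.

HONEST FRAMING: exact (Metropolis-corrected) sampling algorithms for lattice gauge theory; figures
of merit are autocorrelation/cost numbers at stated couplings and volumes; no continuum-physics claim.

This file sits next to, and reuses, `ConstructiveQFTWave0.lean` (`GaugeConfig`, `haarProbability`, …) and the
tree's rigorous Wilson flow `WilsonFlow.lean` (`suProj`, `plaquetteLoopSum`, `wilsonFlow`,
`WilsonFlow.coeConfig`, `WilsonFlow.loopSumAmb`, `hasDerivAt_wilsonFlow`). Companion file B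
(`Luscher2010/FlowActionSeries.lean`) holds the perturbative recursion (4.11)–(4.15), the locality
vocabulary, the finite-volume convergence statement (App. E), the plaquette Laplacian (3.10)/(4.14) and the
Euler step (5.1)/(5.5).

* Part 1 (pure measure theory, any compact group `G`): the trivial measure `D[V]`, the Boltzmann measure
  `𝒵⁻¹ e^{-S} D[U]`, trivializing maps in TRANSPORT form (eq. (2.9)), two proved consequences, the
  change-of-variables identity behind field-transformed HMC (2.13) (proved), and the finite-lattice
  existence statement (§1, via Moser) as a cited `Prop`.
* Part 2 (`G = SU(n) ⊆ M_n(ℂ)`, the conventions of `WilsonFlow.lean`): link derivatives (2.2), the link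
  Laplacian (4.6), generators and flows (3.1)–(3.2) — with the PROVED fact that the tree's `wilsonFlow` is
  the flow map of the Wilson generator —, the Jacobian formula (3.9) in integrated (Liouville) form, the
  trivializing-flow criterion (4.1)–(4.3), Lüscher's operator `𝓛_t` (4.6) and the existence of trivializing
  flows (§4.2, App. E) as cited `Prop`s. Lüscher's volume-UNIFORM convergence question (§4.5(b)) is NOT
  here: it is not a published result and lives under `Summits/Ventures/LatticeQCDFlow/TrivializingMaps/`.
-/

open MeasureTheory
open scoped ENNReal Matrix

namespace Literature.MathematicalPhysics.QuantumFieldTheory.Luscher2010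

open Literature.MathematicalPhysics.QuantumFieldTheory

/-- Local notation for `SU(n) ⊆ M_n(ℂ)`, as in `WilsonFlow.lean`. [folklore] -/
local notation "SU[" n "]" => Matrix.specialUnitaryGroup (Fin n) ℂ

noncomputable section

/-! ## Part 1. Trivializing maps as measure transport -/

section Transport

variable (G : Type*) [Group G] [TopologicalSpace G] [IsTopologicalGroup G]
  [CompactSpace G] [MeasurableSpace G] [BorelSpace G]

/-- The "trivial theory": the product `D[V] = ∏_{(x,μ)} dV(x,μ)` of the normalised invariant
measures of the link variables (finite lattice, `L ≥ 1`).
[cite: Luscher2010Trivializing, §2.1 eq. (2.1) and §2.3 eq. (2.9)] -/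
def trivialMeasure (d L : ℕ) [NeZero L] : Measure (GaugeConfig d L G) :=
  Measure.pi fun _ : Edge d L => haarProbability G

variable {G} {d L : ℕ} [NeZero L]

/-- The partition function `𝒵 = ∫ D[U] e^{-S(U)}` of an action `S`.
[cite: Luscher2010Trivializing, §2.1 eq. (2.1)] -/
def partitionFn (S : GaugeConfig d L G → ℝ) : ℝ≥0∞ :=
  ∫⁻ U, ENNReal.ofReal (Real.exp (-S U)) ∂(trivialMeasure G d L)

/-- The Boltzmann probability measure `𝒵⁻¹ e^{-S(U)} D[U]` whose expectations are `⟨𝒪⟩` (eq. (2.1)).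
For `S = β · wilsonAction ρ` this is Wave 0's `wilsonMeasure ρ β` (same formula).
[cite: Luscher2010Trivializing, §2.1 eq. (2.1)] -/
def boltzmannMeasure (S : GaugeConfig d L G → ℝ) : Measure (GaugeConfig d L G) :=
  (partitionFn S)⁻¹ • (trivialMeasure G d L).withDensity fun U => ENNReal.ofReal (Real.exp (-S U))

/-- **Trivializing map (transport form).** `𝓕` is trivializing for the action `S` when the substitution
`U = 𝓕(V)` maps the theory to the trivial one, `⟨𝒪⟩ = ∫ D[V] 𝒪(𝓕(V))` for all observables, i.e. the
push-forward of `D[V]` under `𝓕` is `𝒵⁻¹ e^{-S} D[U]`. Lüscher's defining condition is the differential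
one, `S(𝓕(V)) - ln det 𝓕_*(V) = constant` (eq. (2.8)), for an orientation-preserving diffeomorphism of
the field manifold; for such `𝓕` the two are equivalent by `D[U] = D[V] det 𝓕_*(V)` (eq. (2.7)). The
transport form needs no differential structure on `G` and is what sampler-exactness lemmas consume.
[cite: Luscher2010Trivializing, §2.3 eqs. (2.7)–(2.9)] -/
def IsTrivializingMap (S : GaugeConfig d L G → ℝ) (F : GaugeConfig d L G → GaugeConfig d L G) : Prop :=
  Measurable F ∧ Measure.map F (trivialMeasure G d L) = boltzmannMeasure S

/-- Eq. (2.9): for a trivializing map, `⟨𝒪⟩ = ∫ D[V] 𝒪(𝓕(V))` ("such trivializing maps thus contain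
the entire dynamics of the theory"). [cite: Luscher2010Trivializing, §2.3 eq. (2.9)] -/
theorem IsTrivializingMap.integral_comp {S : GaugeConfig d L G → ℝ}
    {F : GaugeConfig d L G → GaugeConfig d L G} (hF : IsTrivializingMap S F)
    {O : GaugeConfig d L G → ℝ} (hO : AEStronglyMeasurable O (boltzmannMeasure S)) :
    ∫ U, O U ∂(boltzmannMeasure S) = ∫ V, O (F V) ∂(trivialMeasure G d L) := by
  rw [← hF.2] at hO ⊢
  exact integral_map hF.1.aemeasurable hO

/-- Trivializing maps are not unique: precomposing with any `D[V]`-preserving map gives another one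
(Lüscher §4.2: "since it is a scalar equation, one expects that there are many solutions").
[cite: Luscher2010Trivializing, §4.2] -/
theorem IsTrivializingMap.comp_measurePreserving {S : GaugeConfig d L G → ℝ}
    {F R : GaugeConfig d L G → GaugeConfig d L G} (hF : IsTrivializingMap S F)
    (hR : MeasurePreserving R (trivialMeasure G d L) (trivialMeasure G d L)) :
    IsTrivializingMap S (F ∘ R) := by
  refine ⟨hF.1.comp hR.measurable, ?_⟩
  rw [← Measure.map_map hF.1 hR.measurable, hR.map_eq, hF.2]

/-- **Change of variables for field-transformed HMC** (§2.4 eq. (2.13), §6.1): if `𝓕` has Jacobian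
density `J` with respect to `D[V]`, i.e. `𝓕_*(J · D[V]) = D[U]` (for a diffeomorphism, `J = det 𝓕_*` by
eq. (2.7)), then `𝓕` pushes the pulled-back weight `e^{-S(𝓕(V))} J(V) D[V] = e^{-{S(𝓕(V)) - ln det 𝓕_*(V)}} D[V]`
forward to `e^{-S(U)} D[U]`. This is the exactness statement behind "HMC in the variables `V`": ANY
bijective differentiable substitution, trivializing or not, samples the right law once the Jacobian is
included in the simulated action. PROVED (pure measure theory).
[cite: Luscher2010Trivializing, §2.3 eq. (2.7), §2.4 eq. (2.13)] -/
theorem map_withDensity_pullback {F : GaugeConfig d L G → GaugeConfig d L G} (hF : Measurable F)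
    {J : GaugeConfig d L G → ℝ≥0∞}
    (hFJ : Measure.map F ((trivialMeasure G d L).withDensity J) = trivialMeasure G d L)
    {S : GaugeConfig d L G → ℝ} (hS : Measurable S) :
    Measure.map F (((trivialMeasure G d L).withDensity J).withDensity
        fun V => ENNReal.ofReal (Real.exp (-S (F V)))) =
      (trivialMeasure G d L).withDensity fun U => ENNReal.ofReal (Real.exp (-S U)) := by
  have hg : Measurable fun U => ENNReal.ofReal (Real.exp (-S U)) :=
    ENNReal.measurable_ofReal.comp (Real.measurable_exp.comp hS.neg)
  set μ := (trivialMeasure G d L).withDensity J with hμ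
  ext s hs
  rw [Measure.map_apply hF hs, withDensity_apply _ (hF hs), withDensity_apply _ hs, ← hFJ,
    Measure.restrict_map hF hs, lintegral_map hg hF]

end Transport

/-! ## Part 2. Link calculus and flows in field space (`G = SU(n)`) -/

section Flows

variable {d L n : ℕ}

/-- Ambient (matrix-valued) configurations `M_n(ℂ)^E`; the field manifold `SU(n)^E` sits inside via
`WilsonFlow.coeConfig` (Lüscher §2.1: "the space of lattice gauge fields is a power of SU(3) and therefore
a compact connected manifold"). [folklore] -/
abbrev AmbConfig (d L n : ℕ) : Type := GaugeConfig d L (Matrix (Fin n) (Fin n) ℂ)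

-- The Lie algebra `𝔰𝔲(n)` (anti-hermitian traceless matrices, [Luscher2010Trivializing, App. A.1])
-- is the tree's `suAlgebra n` (`ConstructiveQFTBalabanRG.lean`, `mem_suAlgebra_iff`); review of
-- p244629 asked not to re-declare it.

/-- **Link derivative** `∂_{e,X} f(U) = d/ds f(U_s)|_{s=0}`, `U_s(e) = e^{sX} U(e)`, other links fixed
(eq. (2.2); `∂^a_{x,μ}` is the case `X = T^a`). Instance-free: a derivative of a real function of one real
variable. [cite: Luscher2010Trivializing, §2.2 eq. (2.2), App. A eq. (A.3)] -/
def linkDeriv (e : Edge d L) (X : Matrix (Fin n) (Fin n) ℂ) (f : AmbConfig d L n → ℝ)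
    (W : AmbConfig d L n) : ℝ :=
  deriv (fun s : ℝ => f (Function.update W e (NormedSpace.exp ((s : ℂ) • X) * W e))) 0

/-- A basis `(T^a)` of `𝔰𝔲(n)` with `tr(T^a T^b) = -½ δ^{ab}` (App. A.1 (A.1)–(A.2)); the divergence and
the Laplacian are sums over it (and do not depend on the choice). Taken as data.
[cite: Luscher2010Trivializing, App. A.1 eqs. (A.1)–(A.2), (A.5)] -/
structure SuBasis (n : ℕ) where
  /-- index type (`a = 1, …, n² - 1`) -/
  ι : Type
  [fintype : Fintype ι]
  [decEq : DecidableEq ι]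
  /-- the generators `T^a` -/
  T : ι → Matrix (Fin n) (Fin n) ℂ
  mem : ∀ a, T a ∈ suAlgebra n
  /-- `tr(T^a T^b) = -½ δ^{ab}` -/
  orth : ∀ a b, (T a * T b).trace = if a = b then -(1 / 2 : ℂ) else 0
  /-- completeness: the `T^a` span `𝔰𝔲(n)` over `ℝ` -/
  span : ∀ X ∈ suAlgebra n, ∃ c : ι → ℝ, X = ∑ a, (c a : ℂ) • T a

attribute [instance] SuBasis.fintype SuBasis.decEq

/-- Coordinates `Z^a = -2 Re tr(T^a Z)` of `Z ∈ 𝔰𝔲(n)` (App. A.3 eq. (A.10)).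
[cite: Luscher2010Trivializing, App. A.3 eq. (A.10)] -/
def SuBasis.coord (B : SuBasis n) (a : B.ι) (Z : Matrix (Fin n) (Fin n) ℂ) : ℝ :=
  -2 * (B.T a * Z).trace.re

/-- **Lüscher's link Laplacian** `Δ = -∑_{x,μ} ∂^a_{x,μ} ∂^a_{x,μ}` (a non-negative operator; "coincides
with the colour-electric part of the Hamilton operator in 4+1 dimensions"; its eigenfunctions are products
of representation functions of the link variables; zero mode = constants; smallest non-zero eigenvalue
`4/3` for `SU(3)`). [cite: Luscher2010Trivializing, §4.2 eq. (4.6), §4.3 (after eq. (4.13))] -/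
def linkLap [NeZero L] (B : SuBasis n) (f : AmbConfig d L n → ℝ) (W : AmbConfig d L n) : ℝ :=
  -∑ e : Edge d L, ∑ a : B.ι, linkDeriv e (B.T a) (linkDeriv e (B.T a) f) W

/-- A (time-dependent) **generator** of infinitesimal field transformations `U → U + ε Z(U) U` (eq.
(3.1)): a Lie-algebra-valued link field `[Z_t(U)](x,μ)`, here on ambient configurations.
[cite: Luscher2010Trivializing, §3.1 eq. (3.1)] -/
abbrev Generator (d L n : ℕ) : Type := ℝ → AmbConfig d L n → AmbConfig d L n

/-- `Z` is tangent to the field manifold: `Z_t(U)(e) ∈ 𝔰𝔲(n)` on `SU(n)^E`.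
[cite: Luscher2010Trivializing, §3.1] -/
def Generator.IsTangent (Z : Generator d L n) : Prop :=
  ∀ t (U : GaugeConfig d L SU[n]) e, Z t (WilsonFlow.coeConfig U) e ∈ suAlgebra n

/-- **The flow equation** `U̇_t = Z_t(U_t) U_t` (eq. (3.2)) for a curve of ambient configurations, stated
ENTRYWISE (instance-free), as `IsWilsonFlowLine` does. [cite: Luscher2010Trivializing, §3.1 eq. (3.2)] -/
def IsFlowLine (Z : Generator d L n) (U : ℝ → AmbConfig d L n) : Prop :=
  ∀ (t : ℝ) (e : Edge d L) (i j : Fin n),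
    HasDerivAt (fun s : ℝ => U s e i j) ((Z t (U t) e * U t e) i j) t

/-- `Φ t` is the **integrated transformation** `V ↦ U_t = 𝓕_t(V)` of the field manifold (§3.2): `Φ 0 = id`
and each `t ↦ Φ t V` is a flow line. [cite: Luscher2010Trivializing, §3.2] -/
def IsFlowMap (Z : Generator d L n) (Φ : ℝ → GaugeConfig d L SU[n] → GaugeConfig d L SU[n]) : Prop :=
  (∀ V, Φ 0 V = V) ∧ ∀ V, IsFlowLine Z fun t => WilsonFlow.coeConfig (Φ t V)

/-- The (time-independent) **Wilson-flow generator** `[Z(U)](x,μ) = -𝒫{Ω_{x,μ}(U)}` (eq. (5.3); `𝒫` =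
`suProj`, `Ω` = `WilsonFlow.loopSumAmb`, the sum of the `2(d-1)` plaquette loops through the link).
[cite: Luscher2010Trivializing, §5.1 eqs. (5.3)–(5.4)] -/
def wilsonGenerator : Generator d L n := fun _ W e => -suProj (WilsonFlow.loopSumAmb W e.1 e.2)

/-- The tree's rigorous `wilsonFlow` (global existence and uniqueness proved in `WilsonFlow.lean`) IS the
integrated transformation of the Wilson generator in the sense of `IsFlowMap` — the dictionary between this
file's flow interface and the tree. [cite: Luscher2010Trivializing, §3.1 eq. (3.2), §5.1 eq. (5.3)] -/
theorem isFlowMap_wilsonFlow [NeZero L] :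
    IsFlowMap (wilsonGenerator (d := d) (L := L) (n := n)) (fun t U => wilsonFlow t U) := by
  refine ⟨fun V => wilsonFlow_zero V, fun V t e i j => ?_⟩
  have h := hasDerivAt_wilsonFlow V t e i j
  rw [← WilsonFlow.vfAmb_coeConfig, WilsonFlow.vfAmb_apply] at h
  simpa only [wilsonGenerator, WilsonFlow.coeConfig_apply] using h

/-- **Divergence** of a vector field on the field manifold, `∑_{x,μ} ∂^a_{x,μ} [Z(U)]^a(x,μ)` — the integrand
of the Jacobian formula (3.9). [cite: Luscher2010Trivializing, §3.2 eq. (3.9)] -/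
def linkDiv [NeZero L] (B : SuBasis n) (Z : AmbConfig d L n → AmbConfig d L n)
    (W : AmbConfig d L n) : ℝ :=
  ∑ e : Edge d L, ∑ a : B.ι, linkDeriv e (B.T a) (fun W' => B.coord a (Z W' e)) W

/-- **Lüscher's operator** `𝓛_t = ∑_{x,μ} {-∂^a∂^a + t (∂^a S) ∂^a} = Δ + t (∂S)·∂` (eq. (4.6)): minus the
generator of the Langevin dynamics of `e^{-tS} D[U]`; symmetric for `(φ,ψ)_t = ∫ D[U] e^{-tS} φ ψ` (4.7) with
`(φ, 𝓛_t φ)_t = ∑ ‖∂φ‖²_t ≥ 0` (4.8), zero mode = constants, purely discrete spectrum with a gap.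
[cite: Luscher2010Trivializing, §4.2 eqs. (4.5)–(4.8)] -/
def luscherL [NeZero L] (B : SuBasis n) (S : AmbConfig d L n → ℝ) (t : ℝ)
    (φ : AmbConfig d L n → ℝ) (W : AmbConfig d L n) : ℝ :=
  linkLap B φ W + t * ∑ e : Edge d L, ∑ a : B.ι, linkDeriv e (B.T a) S W * linkDeriv e (B.T a) φ W

/-- The `𝔰𝔲(n)`-valued gradient `∂f = T^a ∂^a f` of a real function, as a link field (the generator
`Z_t = -∂S̃_t` of eq. (4.4) is `-linkGrad`). [cite: Luscher2010Trivializing, §4.2 eq. (4.4), App. A (A.4)] -/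
def linkGrad (B : SuBasis n) (f : AmbConfig d L n → ℝ) (W : AmbConfig d L n) : AmbConfig d L n :=
  fun e => ∑ a : B.ι, ((linkDeriv e (B.T a) f W : ℝ) : ℂ) • B.T a

section Smooth

open scoped Matrix.Norms.Frobenius

/-- **Existence of trivializing maps on a finite lattice** (§1: "On a finite lattice, and if the gauge
group is compact and connected, the existence of such trivializing maps is guaranteed by a general theorem
on volume forms on compact manifolds" — Moser 1965 / Moser–Zehnder Thm. 1.26 —; constructively §4.2 +
App. E). Rendered for `G = SU(n)` with the field manifold `SU(n)^E ⊆ M_n(ℂ)^E` presented ambiently: for a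
smooth action there is a bijection `Φ` of `SU(n)^E` which is the restriction of a smooth ambient map whose
inverse is also the restriction of a smooth ambient map (a diffeomorphism of the field manifold), pushing
`D[V]` forward to `𝒵⁻¹ e^{-S} D[U]` (transport form of eq. (2.8), equivalent for diffeomorphisms by (2.7)).
The smoothness is the content (a merely measurable transport map exists for any two atomless standard
probability spaces); orientation is not recorded (the transport form only sees `|det 𝓕_*|`).
[cite: Luscher2010Trivializing, §1 (citing Moser–Zehnder Thm. 1.26), §2.3 eqs. (2.7)–(2.9), §4.2] -/
def TrivializingMapExists (d L n : ℕ) : Prop :=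
  ∀ [NeZero L] (S : AmbConfig d L n → ℝ), ContDiff ℝ (⊤ : ℕ∞) S →
    ∃ (F G : AmbConfig d L n → AmbConfig d L n) (Φ : GaugeConfig d L SU[n] ≃ GaugeConfig d L SU[n]),
      ContDiff ℝ (⊤ : ℕ∞) F ∧ ContDiff ℝ (⊤ : ℕ∞) G ∧
      (∀ V, WilsonFlow.coeConfig (Φ V) = F (WilsonFlow.coeConfig V)) ∧
      (∀ U, WilsonFlow.coeConfig (Φ.symm U) = G (WilsonFlow.coeConfig U)) ∧
      IsTrivializingMap (fun U : GaugeConfig d L SU[n] => S (WilsonFlow.coeConfig U)) Φ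

/-- **Global existence, uniqueness and smoothness of flows** (§3.1, citing Arnold §35): "If `Z_t(U)` is a
differentiable function of `t` and `U`, the flow equation (3.2) has a unique solution `U_t` for any
specified initial value `U_0 = V` and all `t ∈ (-∞,∞)`. Moreover, the solution is differentiable with
respect to `t` and `V` … the existence of the solution for all times … can only be guaranteed, without
further assumptions, because the field manifold is compact." Rendered: a `C¹` tangent generator has a flow
map of `SU(n)^E`, jointly continuous, with unique flow lines. (For the Wilson generator this is PROVED in
the tree: `isWilsonFlowLine_wilsonFlow`, `IsWilsonFlowLine.unique`, `continuous_wilsonFlow_uncurry`.)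
[cite: Luscher2010Trivializing, §3.1 (paragraph after eq. (3.3))] -/
def FlowGlobalExistence (d L n : ℕ) : Prop :=
  ∀ [NeZero L] (Z : Generator d L n),
    ContDiff ℝ 1 (fun p : ℝ × AmbConfig d L n => Z p.1 p.2) → Z.IsTangent →
    ∃ Φ : ℝ → GaugeConfig d L SU[n] → GaugeConfig d L SU[n], IsFlowMap Z Φ ∧
      Continuous (fun p : ℝ × GaugeConfig d L SU[n] => Φ p.1 p.2) ∧
      ∀ (U : ℝ → AmbConfig d L n) (V : GaugeConfig d L SU[n]),
        IsFlowLine Z U → U 0 = WilsonFlow.coeConfig V → ∀ t, U t = WilsonFlow.coeConfig (Φ t V)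

/-- **Jacobian of the integrated transformation** (eq. (3.9)):
`ln det 𝓕_{t*}(V) = ∫₀ᵗ ds ∑_{x,μ} {∂^a_{x,μ} [Z_s(U)]^a(x,μ)}_{U=U_s}`, in the integrated (Liouville /
change-of-variables) form in which it is used: for every `t` and every continuous observable,
`∫ D[U] 𝒪(U) = ∫ D[V] 𝒪(𝓕_t V) · exp(∫₀ᵗ div Z_s(𝓕_s V) ds)`. (This is also the "instantaneous change of
variables" of continuous normalizing flows.) [cite: Luscher2010Trivializing, §3.2 eqs. (3.4)–(3.9)] -/
def JacobianFormula (d L n : ℕ) : Prop :=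
  ∀ [NeZero L] (B : SuBasis n) (Z : Generator d L n) (Φ : ℝ → GaugeConfig d L SU[n] → GaugeConfig d L SU[n]),
    ContDiff ℝ 1 (fun p : ℝ × AmbConfig d L n => Z p.1 p.2) → Z.IsTangent → IsFlowMap Z Φ →
    ∀ (t : ℝ) (O : GaugeConfig d L SU[n] → ℝ), Continuous O →
      ∫ U, O U ∂(trivialMeasure SU[n] d L) =
        ∫ V, O (Φ t V) * Real.exp (∫ s in (0 : ℝ)..t, linkDiv B (Z s) (WilsonFlow.coeConfig (Φ s V)))
          ∂(trivialMeasure SU[n] d L)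

/-- **Trivializing-flow criterion** (eqs. (4.1)–(4.3)): if a smooth tangent generator satisfies the linear
first-order condition `∑_{x,μ} {∂^a Z^a_t - t (∂^a S) Z^a_t} = S + Ċ_t` with `Ċ_t` field-independent, then
`S(𝓕_t(V)) - ln det 𝓕_{t*}(V) = (1-t) S(𝓕_t(V)) - C_t` (4.2); in particular `𝓕_1` is a trivializing map
for `S` ("it suffices to find a generator `Z_t(U)` that satisfies eq. (4.3)").
[cite: Luscher2010Trivializing, §4.1 eqs. (4.1)–(4.3)] -/
def TrivializingFlowCriterion (d L n : ℕ) : Prop :=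
  ∀ [NeZero L] (B : SuBasis n) (S : AmbConfig d L n → ℝ) (Z : Generator d L n)
    (Φ : ℝ → GaugeConfig d L SU[n] → GaugeConfig d L SU[n]) (C' : ℝ → ℝ),
    ContDiff ℝ 1 S → ContDiff ℝ 1 (fun p : ℝ × AmbConfig d L n => Z p.1 p.2) → Z.IsTangent →
    IsFlowMap Z Φ → Continuous C' →
    (∀ t (U : GaugeConfig d L SU[n]),
      linkDiv B (Z t) (WilsonFlow.coeConfig U)
        - t * ∑ e : Edge d L, ∑ a : B.ι, linkDeriv e (B.T a) S (WilsonFlow.coeConfig U)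
            * B.coord a (Z t (WilsonFlow.coeConfig U) e)
        = S (WilsonFlow.coeConfig U) + C' t) →
    IsTrivializingMap (fun U => S (WilsonFlow.coeConfig U)) (Φ 1)

/-- **Existence of trivializing flows** (§4.2 with App. E): for a smooth action there is a family of flow
actions `S̃_t`, smooth in `(t,U)`, solving `𝓛_t S̃_t = S + Ċ_t` with `Ċ_t = -(1,S)_t/(1,1)_t` (eqs. (4.5),
(4.9), (4.10)); the gradient generator `Z_t = -∂S̃_t` (4.4) then satisfies (4.3) and `𝓕_1` is a trivializing
DIFFEOMORPHISM — "a constructive proof of the existence of trivializing flows has thus been given". Proof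
inputs: ellipticity, discrete spectrum (Gilkey §1.6), zero mode = constants, spectral gap, elliptic
regularity + Sobolev on the compact field manifold (App. E).
[cite: Luscher2010Trivializing, §4.2 eqs. (4.4)–(4.10), App. E] -/
def TrivializingFlowExists (d L n : ℕ) : Prop :=
  ∀ [NeZero L] (B : SuBasis n) (S : AmbConfig d L n → ℝ), ContDiff ℝ (⊤ : ℕ∞) S →
    ∃ (Sflow : ℝ → AmbConfig d L n → ℝ) (C' : ℝ → ℝ),
      ContDiff ℝ (⊤ : ℕ∞) (fun p : ℝ × AmbConfig d L n => Sflow p.1 p.2) ∧ Continuous C' ∧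
      ∀ t (U : GaugeConfig d L SU[n]),
        luscherL B S t (Sflow t) (WilsonFlow.coeConfig U) = S (WilsonFlow.coeConfig U) + C' t


end Smooth

end Flows

end

end Literature.MathematicalPhysics.QuantumFieldTheory.Luscher2010
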